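import Literature.NumberTheory.ComplexMultiplication.CMTorusPolarizations
import Literature.NumberTheory.ComplexMultiplication.CMTypeBasic
import HarnessLib

/-!
# Weil-type family coverage — the pair-count identity for CM types and the sign parity of a skew element
# (kernel form of the census's law b01.23 (B) / THEOREM F (F1))

research route conditional on HC_CM; not a corollary; Q11.4-sentence-2 already refuted in dim ≥ 3.

Ring 2, WEIL-TYPE FAMILY-COVERAGE CENSUS (`HOME/WEIL-FAMILY-COVERAGE.md` `## b01`, blocks b01.23 (B) and b01.28
THEOREM F (F1), owner ring2-b01).  The census decides principal polarisability of the simple CM points with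
cyclotomic CM and `K`-balanced (Weil-type) CM type `Φ` through ONE parity bit `wt(s_Φ) (mod 2)`, the number of
`φ ∈ Φ` at which a fixed skew generator `ξ₀` of the inverse different has `Im ξ₀^φ < 0`, and observes that this
bit «is a law in `(M, K)` alone».  This file proves the underlying combinatorics for the tree's CM types
`Literature.AlgebraicGeometry.Motives.CMType K` (sets `Φ` of complex embeddings with `φ ∈ Φ ↔ φ̄ ∉ Φ`) of an
ARBITRARY number field / CM field `K`:

* §1 `prod_pos_iff_even_card_filter_neg` — a product of non-zero reals is positive iff the number of negative
  factors is even.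
* §2 **Pair-count identity** (census b01.23 (B) «`|Φ ∩ N| + |Φ ∩ N′| ≡ d(N, N′) (mod 2)`», here as an
  identity of integers): for CM types `Φ, N, N′`, `|Φ ∩ N| + |Φ ∩ N′| = 2·|Φ ∩ N ∩ N′| + |N ∖ N′|`
  (`ncard_inter_add_ncard_inter_eq`; conjugation carries `N ∖ N′ ∖ Φ` onto `Φ ∩ N′ ∖ N`), its parity form, and
  **Φ-independence** `ncard_inter_mod_two_eq_of_mod_two_eq`: `|Φ ∩ N| (mod 2)` depends only on `|Φ ∩ N′| (mod 2)`.
* §3 For a CM field `K` (`IsCMField K`, `ρ = complexConj K`): a skew `ζ₀ ≠ 0` (`ζ₀^ρ = −ζ₀`) is purely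
  imaginary and non-zero at every `φ`, a real `u ≠ 0` (`u^ρ = u`) is real and non-zero at every `φ`; **the
  negative set `N(ζ₀) = {φ : Im ζ₀^φ < 0}` is a CM type** (`mem_negSet_iff_conjugate_notMem`);
  `∏_{φ∈Φ} Im ζ₀^φ > 0 ⟺ #{φ ∈ Φ : Im ζ₀^φ < 0}` even (`prod_im_pos_iff_even`), likewise for `Re u^φ`
  (`prod_re_pos_iff_even` — for a unit `u` of `K₀` the product is its norm to `ℚ`); and THEOREM F (F1) in
  intrinsic form, `ncard_negSet_mod_two_eq_of_mod_two_eq`: for ANY CM type `Ψ`, CM types `Φ, Φ′` with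
  `|Φ ∩ Ψ| ≡ |Φ′ ∩ Ψ| (mod 2)` have `#{φ ∈ Φ : Im ζ₀^φ < 0} ≡ #{φ ∈ Φ′ : Im ζ₀^φ < 0} (mod 2)` (census:
  `Ψ = N_K`, the type induced from the imaginary quadratic field `K` of the Weil structure; `|Φ ∩ N_K| = g/2`
  is the `K`-balanced = signature-`(n,n)` condition, so all `K`-balanced `Φ` share the bit), with the closed
  form `even_ncard_negSet_add` («`wt(s_Φ) ≡ |Φ ∩ N_K| + d(N, N_K)`»).

Consumer: `Theorems/Ring2WeilCoverageCMUnitSignature.lean` (the unit-signature criterion for `Φ`-positive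
divisors of type `𝔣₀` on Shimura's principal CM tori and the resulting obstruction / existence statements).
HONEST FRAMING: elementary counting; the analytic input (F0) of the census (`N(ξ₀) =` the odd positions of
`(ℤ/M)ˣ` for `ξ₀ = ζ^{g−1}/Φ′_M(ζ)`) is NOT proved here.  No `def`, no named fact, no `sorry`; nothing here is a
statement about Hodge classes; `HC_CM` is used nowhere.  Seat-derived [folklore]; the CM-type axiom is
[cite: Shimura1998, §5.2, pp. 40–41].
-/

noncomputable section

open scoped Classical ComplexConjugate
open NumberField NumberField.ComplexEmbedding Complex

namespace Summit.HodgeConjecture.Ring2WeilCoverage.CMTypeSignParity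

open Literature.AlgebraicGeometry.Motives (CMType)
open Literature.NumberTheory.ComplexMultiplication

/-! ### §1 A product of non-zero reals is positive iff the number of negative factors is even -/

section SignLemma

/-- **Sign of a product**: for non-zero real factors, `0 < ∏_{i ∈ s} f i` iff the number of `i ∈ s` with
`f i < 0` is even (induction on `s`).
research route conditional on HC_CM; not a corollary; Q11.4-sentence-2 already refuted in dim ≥ 3. [folklore] -/
theorem prod_pos_iff_even_card_filter_neg {ι : Type*} (s : Finset ι) (f : ι → ℝ)
    (hf : ∀ i ∈ s, f i ≠ 0) :
    (0 < ∏ i ∈ s, f i) ↔ Even ((s.filter fun i => f i < 0).card) := by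
  induction s using Finset.induction_on with
  | empty => simp
  | insert a s ha ih =>
    have hfa : f a ≠ 0 := hf a (Finset.mem_insert_self a s)
    have hf' : ∀ i ∈ s, f i ≠ 0 := fun i hi => hf i (Finset.mem_insert_of_mem hi)
    have ih' := ih hf'
    have hP : ∏ i ∈ s, f i ≠ 0 := Finset.prod_ne_zero_iff.mpr hf'
    rw [Finset.prod_insert ha, Finset.filter_insert]
    by_cases hneg : f a < 0
    · have hnot : a ∉ s.filter fun i => f i < 0 := fun h => ha (Finset.mem_filter.mp h).1
      rw [if_pos hneg, Finset.card_insert_of_notMem hnot, Nat.even_add_one, ← ih']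
      constructor
      · intro h hpos
        have : f a * ∏ i ∈ s, f i < 0 := mul_neg_of_neg_of_pos hneg hpos
        linarith
      · intro h
        exact mul_pos_of_neg_of_neg hneg (lt_of_le_of_ne (not_lt.mp h) hP)
    · have hpos : 0 < f a := lt_of_le_of_ne (not_lt.mp hneg) (Ne.symm hfa)
      rw [if_neg hneg, ← ih']
      constructor
      · intro h
        by_contra hle
        have : f a * ∏ i ∈ s, f i < 0 := mul_neg_of_pos_of_neg hpos (lt_of_le_of_ne (not_lt.mp hle) hP)
        linarith
      · exact fun h => mul_pos hpos h

end SignLemma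

variable {K : Type} [Field K] [NumberField K]

/-! ### §2 The pair-count identity for three CM types (census b01.23 (B)) -/

section ParityLaw

/-- **Pair-count identity, filtered form.**  For CM types `Φ, N, N′` of `K` (each a transversal of the
conjugate pairs `{φ, φ̄}` of complex embeddings):
`#{φ ∈ Φ ∩ N} + #{φ ∈ Φ ∩ N′} = 2·#{φ ∈ Φ ∩ N ∩ N′} + #{φ ∈ N ∖ N′}` — conjugation carries
`N ∖ N′ ∖ Φ` bijectively onto `Φ ∩ N′ ∖ N`.  Seat-derived (census b01.23 (B)).
research route conditional on HC_CM; not a corollary; Q11.4-sentence-2 already refuted in dim ≥ 3. [folklore] -/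
theorem card_filter_inter_add_card_filter_inter_eq (Φ N N' : CMType K) :
    (Finset.univ.filter fun φ : K →+* ℂ => φ ∈ Φ.1 ∧ φ ∈ N.1).card +
        (Finset.univ.filter fun φ : K →+* ℂ => φ ∈ Φ.1 ∧ φ ∈ N'.1).card =
      2 * (Finset.univ.filter fun φ : K →+* ℂ => φ ∈ Φ.1 ∧ φ ∈ N.1 ∧ φ ∈ N'.1).card +
        (Finset.univ.filter fun φ : K →+* ℂ => φ ∈ N.1 ∧ φ ∉ N'.1).card := by
  -- split `[Φ ∧ N]` along `N'`
  have h1 : (Finset.univ.filter fun φ : K →+* ℂ => φ ∈ Φ.1 ∧ φ ∈ N.1).card =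
      (Finset.univ.filter fun φ : K →+* ℂ => φ ∈ Φ.1 ∧ φ ∈ N.1 ∧ φ ∈ N'.1).card +
        (Finset.univ.filter fun φ : K →+* ℂ => φ ∈ Φ.1 ∧ φ ∈ N.1 ∧ φ ∉ N'.1).card := by
    rw [← Finset.card_filter_add_card_filter_not (p := fun φ : K →+* ℂ => φ ∈ N'.1),
      Finset.filter_filter, Finset.filter_filter]
    congr 1
    · congr 1; ext φ; simp only [Finset.mem_filter, and_assoc]
    · congr 1; ext φ; simp only [Finset.mem_filter, and_assoc]
  -- split `[Φ ∧ N']` along `N`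
  have h2 : (Finset.univ.filter fun φ : K →+* ℂ => φ ∈ Φ.1 ∧ φ ∈ N'.1).card =
      (Finset.univ.filter fun φ : K →+* ℂ => φ ∈ Φ.1 ∧ φ ∈ N.1 ∧ φ ∈ N'.1).card +
        (Finset.univ.filter fun φ : K →+* ℂ => φ ∈ Φ.1 ∧ φ ∉ N.1 ∧ φ ∈ N'.1).card := by
    rw [← Finset.card_filter_add_card_filter_not (p := fun φ : K →+* ℂ => φ ∈ N.1),
      Finset.filter_filter, Finset.filter_filter]
    congr 1
    · congr 1; ext φ; simp only [Finset.mem_filter]; tauto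
    · congr 1; ext φ; simp only [Finset.mem_filter]; tauto
  -- split `[N ∧ ¬N']` along `Φ`
  have h3 : (Finset.univ.filter fun φ : K →+* ℂ => φ ∈ N.1 ∧ φ ∉ N'.1).card =
      (Finset.univ.filter fun φ : K →+* ℂ => φ ∈ Φ.1 ∧ φ ∈ N.1 ∧ φ ∉ N'.1).card +
        (Finset.univ.filter fun φ : K →+* ℂ => φ ∉ Φ.1 ∧ φ ∈ N.1 ∧ φ ∉ N'.1).card := by
    rw [← Finset.card_filter_add_card_filter_not (p := fun φ : K →+* ℂ => φ ∈ Φ.1),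
      Finset.filter_filter, Finset.filter_filter]
    congr 1
    · congr 1; ext φ; simp only [Finset.mem_filter]; tauto
    · congr 1; ext φ; simp only [Finset.mem_filter]; tauto
  -- conjugation carries `[¬Φ ∧ N ∧ ¬N']` onto `[Φ ∧ ¬N ∧ N']`
  have h4 : (Finset.univ.filter fun φ : K →+* ℂ => φ ∉ Φ.1 ∧ φ ∈ N.1 ∧ φ ∉ N'.1).card =
      (Finset.univ.filter fun φ : K →+* ℂ => φ ∈ Φ.1 ∧ φ ∉ N.1 ∧ φ ∈ N'.1).card := by
    rw [← Finset.card_image_of_injective _ (involutive_conjugate K).injective]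
    congr 1
    ext φ
    simp only [Finset.mem_image, Finset.mem_filter, Finset.mem_univ, true_and]
    constructor
    · rintro ⟨ψ, ⟨hΦ, hN, hN'⟩, rfl⟩
      exact ⟨(CMTypeOps.conjugate_mem_iff_notMem Φ ψ).mpr hΦ,
        fun h => ((CMTypeOps.mem_iff_conjugate_notMem N ψ).mp hN) h,
        (CMTypeOps.conjugate_mem_iff_notMem N' ψ).mpr hN'⟩
    · rintro ⟨hΦ, hN, hN'⟩
      refine ⟨conjugate φ, ⟨?_, ?_, ?_⟩, involutive_conjugate K φ⟩
      · exact fun h => ((CMTypeOps.conjugate_mem_iff_notMem Φ φ).mp h) hΦ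
      · exact (CMTypeOps.conjugate_mem_iff_notMem N φ).mpr hN
      · exact fun h => ((CMTypeOps.conjugate_mem_iff_notMem N' φ).mp h) hN'
  omega

/-- **Pair-count identity** (census b01.23 (B), kernel form): for CM types `Φ, N, N′` of a number field,
`|Φ ∩ N| + |Φ ∩ N′| = 2·|Φ ∩ N ∩ N′| + |N ∖ N′|`; in particular `|Φ ∩ N| + |Φ ∩ N′| ≡ d(N, N′) (mod 2)`
with `d(N, N′) = |N ∖ N′| =` the number of conjugate pairs on which `N` and `N′` differ.  Seat-derived.
research route conditional on HC_CM; not a corollary; Q11.4-sentence-2 already refuted in dim ≥ 3. [folklore] -/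
theorem ncard_inter_add_ncard_inter_eq (Φ N N' : CMType K) :
    (Φ.1 ∩ N.1).ncard + (Φ.1 ∩ N'.1).ncard =
      2 * (Φ.1 ∩ N.1 ∩ N'.1).ncard + (N.1 \ N'.1).ncard := by
  have e1 : (Φ.1 ∩ N.1).ncard = (Finset.univ.filter fun φ : K →+* ℂ => φ ∈ Φ.1 ∧ φ ∈ N.1).card := by
    rw [Set.ncard_eq_toFinset_card']; congr 1; ext φ; simp
  have e2 : (Φ.1 ∩ N'.1).ncard = (Finset.univ.filter fun φ : K →+* ℂ => φ ∈ Φ.1 ∧ φ ∈ N'.1).card := by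
    rw [Set.ncard_eq_toFinset_card']; congr 1; ext φ; simp
  have e3 : (Φ.1 ∩ N.1 ∩ N'.1).ncard =
      (Finset.univ.filter fun φ : K →+* ℂ => φ ∈ Φ.1 ∧ φ ∈ N.1 ∧ φ ∈ N'.1).card := by
    rw [Set.ncard_eq_toFinset_card']; congr 1; ext φ; simp
  have e4 : (N.1 \ N'.1).ncard = (Finset.univ.filter fun φ : K →+* ℂ => φ ∈ N.1 ∧ φ ∉ N'.1).card := by
    rw [Set.ncard_eq_toFinset_card']; congr 1; ext φ; simp
  rw [e1, e2, e3, e4]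
  exact card_filter_inter_add_card_filter_inter_eq Φ N N'

/-- **Parity form**: `|Φ ∩ N| + |Φ ∩ N′| + |N ∖ N′|` is even.
research route conditional on HC_CM; not a corollary; Q11.4-sentence-2 already refuted in dim ≥ 3. [folklore] -/
theorem even_ncard_inter_add_ncard_inter_add_ncard_diff (Φ N N' : CMType K) :
    Even ((Φ.1 ∩ N.1).ncard + (Φ.1 ∩ N'.1).ncard + (N.1 \ N'.1).ncard) := by
  rw [ncard_inter_add_ncard_inter_eq]
  exact ⟨(Φ.1 ∩ N.1 ∩ N'.1).ncard + (N.1 \ N'.1).ncard, by ring⟩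

/-- **Φ-independence of `|Φ ∩ N| (mod 2)` on a balance class**: if `|Φ ∩ N′| ≡ |Φ′ ∩ N′| (mod 2)` then
`|Φ ∩ N| ≡ |Φ′ ∩ N| (mod 2)`, for all CM types `Φ, Φ′, N, N′`.
research route conditional on HC_CM; not a corollary; Q11.4-sentence-2 already refuted in dim ≥ 3. [folklore] -/
theorem ncard_inter_mod_two_eq_of_mod_two_eq (Φ Φ' N N' : CMType K)
    (h : (Φ.1 ∩ N'.1).ncard % 2 = (Φ'.1 ∩ N'.1).ncard % 2) :
    (Φ.1 ∩ N.1).ncard % 2 = (Φ'.1 ∩ N.1).ncard % 2 := by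
  have h1 := ncard_inter_add_ncard_inter_eq Φ N N'
  have h2 := ncard_inter_add_ncard_inter_eq Φ' N N'
  omega

end ParityLaw

/-! ### §3 Skew and real elements of a CM field at the complex embeddings; the negative set of a skew element -/

section Skew

variable [IsCMField K]

/-- `ζ₀^φ` is purely imaginary for a skew `ζ₀` (`ζ₀^ρ = −ζ₀`): `Re ζ₀^φ = 0`.
research route conditional on HC_CM; not a corollary; Q11.4-sentence-2 already refuted in dim ≥ 3. [cite: Shimura1998, §14.2 Prop. 2, p. 102] -/
theorem re_embedding_eq_zero_of_skew {ζ₀ : K} (hζ₀ : IsCMField.complexConj K ζ₀ = -ζ₀)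
    (φ : K →+* ℂ) : (φ ζ₀).re = 0 := by
  have h : conj (φ ζ₀) = -(φ ζ₀) := by
    rw [← IsCMField.complexEmbedding_complexConj, hζ₀, map_neg]
  have := congrArg Complex.re h
  rw [Complex.conj_re, Complex.neg_re] at this
  linarith

/-- `Im ζ₀^φ ≠ 0` for a non-zero skew `ζ₀`.
research route conditional on HC_CM; not a corollary; Q11.4-sentence-2 already refuted in dim ≥ 3. [cite: Shimura1998, §14.2 Prop. 2, p. 102] -/
theorem im_embedding_ne_zero_of_skew {ζ₀ : K} (hζ₀ : IsCMField.complexConj K ζ₀ = -ζ₀)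
    (h0 : ζ₀ ≠ 0) (φ : K →+* ℂ) : (φ ζ₀).im ≠ 0 := by
  intro him
  have hz : φ ζ₀ = 0 := Complex.ext (re_embedding_eq_zero_of_skew hζ₀ φ) him
  exact h0 ((map_eq_zero_iff φ φ.injective).mp hz)

/-- `Re u^φ ≠ 0` for a non-zero real `u` (`u^ρ = u`; `Im u^φ = 0` is the lane's
`CMTypeLattice.im_embedding_eq_zero_of_complexConj_eq`).
research route conditional on HC_CM; not a corollary; Q11.4-sentence-2 already refuted in dim ≥ 3. [cite: Shimura1998, §5.1 Lemma 2, p. 38] -/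
theorem re_embedding_ne_zero_of_real {u : K} (hu : IsCMField.complexConj K u = u) (h0 : u ≠ 0)
    (φ : K →+* ℂ) : (φ u).re ≠ 0 := by
  intro hre
  have hz : φ u = 0 := Complex.ext hre (CMTypeLattice.im_embedding_eq_zero_of_complexConj_eq hu φ)
  exact h0 ((map_eq_zero_iff φ φ.injective).mp hz)

omit [NumberField K] [IsCMField K] in
/-- `Im φ̄(x) = −Im φ(x)`.
research route conditional on HC_CM; not a corollary; Q11.4-sentence-2 already refuted in dim ≥ 3. [folklore] -/
theorem im_conjugate_apply (φ : K →+* ℂ) (x : K) : (conjugate φ x).im = -(φ x).im := by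
  rw [conjugate_coe_eq, Complex.conj_im]

/-- **The negative set `N(ζ₀) = {φ : Im ζ₀^φ < 0}` of a non-zero skew `ζ₀` is a CM type**: it contains
exactly one of each pair `{φ, φ̄}` (`Im ζ₀^{φ̄} = −Im ζ₀^φ ≠ 0`).  In the census (b01.23 Step 1 / b01.28
(F0)) this is the type `N` of `ξ₀ = ζ^{g−1}/Φ′_M(ζ)`.
research route conditional on HC_CM; not a corollary; Q11.4-sentence-2 already refuted in dim ≥ 3. [folklore] -/
theorem mem_negSet_iff_conjugate_notMem {ζ₀ : K} (hζ₀ : IsCMField.complexConj K ζ₀ = -ζ₀)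
    (h0 : ζ₀ ≠ 0) (φ : K →+* ℂ) :
    φ ∈ {ψ : K →+* ℂ | (ψ ζ₀).im < 0} ↔ conjugate φ ∉ {ψ : K →+* ℂ | (ψ ζ₀).im < 0} := by
  simp only [Set.mem_setOf_eq, im_conjugate_apply, neg_lt_zero, not_lt]
  have hne := im_embedding_ne_zero_of_skew hζ₀ h0 φ
  exact ⟨fun h => h.le, fun h => lt_of_le_of_ne h hne⟩

omit [IsCMField K] in
/-- The number of `φ ∈ Φ` with a property `p`, counted on the subtype `Φ`, is `|Φ ∩ {p}|`.
research route conditional on HC_CM; not a corollary; Q11.4-sentence-2 already refuted in dim ≥ 3. [folklore] -/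
theorem card_filter_subtype_eq_ncard (Φ : CMType K) (p : (K →+* ℂ) → Prop) :
    (Finset.univ.filter fun φ : Φ.1 => p φ.1).card = (Φ.1 ∩ {ψ | p ψ}).ncard := by
  have h : Φ.1 ∩ {ψ | p ψ} = Subtype.val '' {φ : Φ.1 | p φ.1} := by
    ext ψ
    constructor
    · rintro ⟨h1, h2⟩; exact ⟨⟨ψ, h1⟩, h2, rfl⟩
    · rintro ⟨φ, hφ, rfl⟩; exact ⟨φ.2, hφ⟩
  rw [h, Set.ncard_image_of_injective _ Subtype.val_injective, Set.ncard_eq_toFinset_card',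
    Set.toFinset_setOf]

/-- **`∏_{φ ∈ Φ} Im ζ₀^φ > 0` iff `#{φ ∈ Φ : Im ζ₀^φ < 0}` is even** (skew `ζ₀ ≠ 0`).
research route conditional on HC_CM; not a corollary; Q11.4-sentence-2 already refuted in dim ≥ 3. [folklore] -/
theorem prod_im_pos_iff_even {ζ₀ : K} (hζ₀ : IsCMField.complexConj K ζ₀ = -ζ₀) (h0 : ζ₀ ≠ 0)
    (Φ : CMType K) :
    (0 < ∏ φ : Φ.1, (φ.1 ζ₀).im) ↔ Even ((Φ.1 ∩ {ψ | (ψ ζ₀).im < 0}).ncard) := by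
  rw [prod_pos_iff_even_card_filter_neg _ _ (fun φ _ => im_embedding_ne_zero_of_skew hζ₀ h0 φ.1),
    card_filter_subtype_eq_ncard Φ (fun ψ => (ψ ζ₀).im < 0)]

/-- **`∏_{φ ∈ Φ} Re u^φ > 0` iff `#{φ ∈ Φ : Re u^φ < 0}` is even** (real `u ≠ 0`).  For a unit `u` of
`𝔬₀` the left side is «`N_{K₀/ℚ}(u) = +1`» (the real places of `K₀` correspond to the elements of `Φ`).
research route conditional on HC_CM; not a corollary; Q11.4-sentence-2 already refuted in dim ≥ 3. [folklore] -/
theorem prod_re_pos_iff_even {u : K} (hu : IsCMField.complexConj K u = u) (h0 : u ≠ 0) (Φ : CMType K) :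
    (0 < ∏ φ : Φ.1, (φ.1 u).re) ↔ Even ((Φ.1 ∩ {ψ | (ψ u).re < 0}).ncard) := by
  rw [prod_pos_iff_even_card_filter_neg _ _ (fun φ _ => re_embedding_ne_zero_of_real hu h0 φ.1),
    card_filter_subtype_eq_ncard Φ (fun ψ => (ψ u).re < 0)]

/-- **Φ-independence of the sign parity of a skew element** (census b01.28 THEOREM F (F1), kernel form):
for a non-zero skew `ζ₀` and ANY CM type `Ψ`, if `|Φ ∩ Ψ| ≡ |Φ′ ∩ Ψ| (mod 2)` then
`#{φ ∈ Φ : Im ζ₀^φ < 0} ≡ #{φ ∈ Φ′ : Im ζ₀^φ < 0} (mod 2)`.  In the census `Ψ = N_K` (the type of `L`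
induced from the imaginary quadratic `K`), `|Φ ∩ N_K| = g/2` for every `K`-balanced `Φ`, so the bit is the
same for all `K`-balanced types — «a law in `(M, K)` alone».
research route conditional on HC_CM; not a corollary; Q11.4-sentence-2 already refuted in dim ≥ 3. [folklore] -/
theorem ncard_negSet_mod_two_eq_of_mod_two_eq {ζ₀ : K} (hζ₀ : IsCMField.complexConj K ζ₀ = -ζ₀)
    (h0 : ζ₀ ≠ 0) (Ψ Φ Φ' : CMType K) (h : (Φ.1 ∩ Ψ.1).ncard % 2 = (Φ'.1 ∩ Ψ.1).ncard % 2) :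
    (Φ.1 ∩ {ψ : K →+* ℂ | (ψ ζ₀).im < 0}).ncard % 2 =
      (Φ'.1 ∩ {ψ : K →+* ℂ | (ψ ζ₀).im < 0}).ncard % 2 :=
  ncard_inter_mod_two_eq_of_mod_two_eq Φ Φ'
    ⟨{ψ : K →+* ℂ | (ψ ζ₀).im < 0}, mem_negSet_iff_conjugate_notMem hζ₀ h0⟩ Ψ h

/-- **Closed form of the bit** (census b01.23 (B): «`wt(s_Φ) ≡ |Φ ∩ N_K| + d(N, N_K)`»):
`#{φ ∈ Φ : Im ζ₀^φ < 0} + |Φ ∩ Ψ| + |N(ζ₀) ∖ Ψ|` is even.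
research route conditional on HC_CM; not a corollary; Q11.4-sentence-2 already refuted in dim ≥ 3. [folklore] -/
theorem even_ncard_negSet_add {ζ₀ : K} (hζ₀ : IsCMField.complexConj K ζ₀ = -ζ₀) (h0 : ζ₀ ≠ 0)
    (Ψ Φ : CMType K) :
    Even ((Φ.1 ∩ {ψ : K →+* ℂ | (ψ ζ₀).im < 0}).ncard + (Φ.1 ∩ Ψ.1).ncard +
      ({ψ : K →+* ℂ | (ψ ζ₀).im < 0} \ Ψ.1).ncard) :=
  even_ncard_inter_add_ncard_inter_add_ncard_diff Φ
    ⟨{ψ : K →+* ℂ | (ψ ζ₀).im < 0}, mem_negSet_iff_conjugate_notMem hζ₀ h0⟩ Ψ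

end Skew

end Summit.HodgeConjecture.Ring2WeilCoverage.CMTypeSignParity

end
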